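import Summits.SmoothPoincare4.SmoothPoincare4.Theses.SullivanDual
import Literature.Geometry.Symplectic.TamingWitness
import Literature.Geometry.Symplectic.JHolomorphicMap

/-!
# Sketch — crux `WitnessCharge` (stmt-SmoothPoincare4-7824), idea `pencil-at-infinity`
(crux-ideate round 1, ideator 2)

First checkable statements of the line, typed over existing declarations only
(`TamingWitness`, `InPuncturedChartBall`, `punctured`, `inversion`, `stdSymplecticForm`,
`IsJHolomorphic`, `MForm`, `IsSmoothForm`, `mextDeriv`). Nothing is proved here; these are the
`Prop`s the crux-plan stage would register as the first (soft, provable-now) stubs.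

* `CollarLemma`      — STEP 0(b): a taming witness at radius `ε` for a `J` standard on the
                        punctured `ε'`-ball (`ε < ε'`) has NO MASS on the whole standard collar:
                        it kills every smooth `2`-form vanishing off `B_{ε'}`.
* `WitnessClosed`    — STEP 0(c): hence it is `d`-closed with no boundary condition at all
                        (`T (dβ) = 0` for every smooth `1`-form `β`), i.e. a compactly supported
                        closed positive `(1,1)`-current = a Sullivan/Cattalani complex cycle,
                        null-homologous because `H₂(Σ∖p) = 0`.
* `WitnessMonotone`  — consequence: a witness at radius `ε` is a witness at every radius
                        `ε'' ∈ [ε, ε')`.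
* `BubbleConfinement`— the maximum principle used twice in the line (bubbles and Brody limits):
                        a non-constant `J`-holomorphic `u : ℂ → Σ∖p` whose image stays away from
                        `p` never enters the standard collar `B_{ε'}` (Liouville for the bounded
                        subharmonic function `max(ρ∘u − 1/ε'² − δ, 0)` on `ℂ`, `ρ = ‖ι(e x − e p)‖²`).
-/

noncomputable section

set_option linter.dupNamespace false

open scoped Manifold ContDiff Topology
open Set Filter Literature.Geometry.Kaehler Literature.Geometry.Symplectic
  Literature.Topology.FourManifolds

namespace Summit.SmoothPoincare4.SmoothPoincare4.Cruxes.WitnessCharge.PencilAtInfinity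

/-- `J² = −1` and `C^∞` smoothness of `J` via `inTangentCoordinates` — verbatim the two clauses of
the crux `WitnessCharge`. -/
def IsAdmissibleACS (S : HomotopySphere 4) (p : S.carrier)
    (J : ∀ x : punctured p, TangentSpace (𝓡 4) x →L[ℝ] TangentSpace (𝓡 4) x) : Prop :=
  (∀ (x : punctured p) (v : TangentSpace (𝓡 4) x), J x (J x v) = -v) ∧
  (∀ x₀ : punctured p, ContMDiffAt (𝓡 4) 𝓘(ℝ, EuclideanSpace ℝ (Fin 4) →L[ℝ] EuclideanSpace ℝ (Fin 4)) ∞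
    (inTangentCoordinates (𝓡 4) (𝓡 4) (id : punctured p → punctured p) id (fun x => J x) x₀) x₀)

/-- `J` is STANDARD on the punctured `ε'`-chart-ball: `⟪A (J v), b⟫ = ω₀ (A v, b)` with
`A = Dι ∘ De`, i.e. `J = (ι ∘ (e − e p))^* i` there — verbatim the clause of `WitnessCharge`. -/
def JStandardOnBall (S : HomotopySphere 4) (p : S.carrier) (ε' : ℝ)
    (J : ∀ x : punctured p, TangentSpace (𝓡 4) x →L[ℝ] TangentSpace (𝓡 4) x) : Prop :=
  ∀ x : punctured p, InPuncturedChartBall p ε' x →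
    ∀ (v : TangentSpace (𝓡 4) x) (b : EuclideanSpace ℝ (Fin 4)),
      inner ℝ (fderiv ℝ inversion (extChartAt (𝓡 4) p x.1 - extChartAt (𝓡 4) p p)
        (mfderiv (𝓡 4) 𝓘(ℝ, EuclideanSpace ℝ (Fin 4))
          (fun z : punctured p => extChartAt (𝓡 4) p z.1) x (J x v))) b
      = stdSymplecticForm (fderiv ℝ inversion (extChartAt (𝓡 4) p x.1 - extChartAt (𝓡 4) p p)
        (mfderiv (𝓡 4) 𝓘(ℝ, EuclideanSpace ℝ (Fin 4))
          (fun z : punctured p => extChartAt (𝓡 4) p z.1) x v)) b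

/-- **First lemma (COLLAR LEMMA, Step 0(b)).** For `J` admissible and standard on `B_{ε'}`,
`0 < ε < ε'`, closed ball inside the chart target: every taming witness `T` at radius `ε` kills
every smooth `2`-form that vanishes off the punctured `ε'`-ball. Informally `supp T ⊆ K_{ε'}`:
the witness never charges the `i`-convex collar. Proof sketch: (W1) + algebraic openness make `T`
order `0` and `≥ 0` on `J`-semipositive forms; `α := d(f(ρ)·λ₀)` with `f' ≥ 0`, `f = 1` near and
beyond the `ε`-sphere, is closed, standard on `B_ε` and `J`-semipositive on `K_ε`
(`λ₀ = ¼ d^c ρ`, `dρ ∧ d^c ρ ≥ 0` on complex lines), so (W3) `T α ≤ 0` and positivity `T α ≥ 0`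
force `T (f ω₀) = 0`; let the support of `f'` sweep the collar. -/
def CollarLemma : Prop :=
  ∀ (S : HomotopySphere 4) (p : S.carrier)
    (J : ∀ x : punctured p, TangentSpace (𝓡 4) x →L[ℝ] TangentSpace (𝓡 4) x) (ε ε' : ℝ),
    0 < ε → ε < ε' →
    Metric.closedBall (extChartAt (𝓡 4) p p) ε' ⊆ (extChartAt (𝓡 4) p).target →
    IsAdmissibleACS S p J → JStandardOnBall S p ε' J →
    ∀ T : MForm (𝓡 4) (punctured p) ℝ 2 →ₗ[ℝ] ℝ, TamingWitness p ε J T →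
    ∀ α : MForm (𝓡 4) (punctured p) ℝ 2, IsSmoothForm α →
      (∀ x : punctured p, ¬ InPuncturedChartBall p ε' x → α x = 0) → T α = 0

/-- **Step 0(c) (WITNESSES ARE CLOSED COMPLEX CYCLES).** Same hypotheses: `T (dβ) = 0` for every
smooth `1`-form `β` on `Σ ∖ p` — no condition on `β` near `p` (combine `CollarLemma` with (W2):
cut `β` off inside `B_{ε'}` away from `supp T`). Together with positivity this says `T` is a
compactly supported, `d`-closed, positive `(1,1)`-current on `(Σ∖p, J)` (a "complex cycle" in the
sense of Sullivan 1976 / Cattalani 2024), null-homologous since `H₂(Σ ∖ p; ℝ) = 0`. -/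
def WitnessClosed : Prop :=
  ∀ (S : HomotopySphere 4) (p : S.carrier)
    (J : ∀ x : punctured p, TangentSpace (𝓡 4) x →L[ℝ] TangentSpace (𝓡 4) x) (ε ε' : ℝ),
    0 < ε → ε < ε' →
    Metric.closedBall (extChartAt (𝓡 4) p p) ε' ⊆ (extChartAt (𝓡 4) p).target →
    IsAdmissibleACS S p J → JStandardOnBall S p ε' J →
    ∀ T : MForm (𝓡 4) (punctured p) ℝ 2 →ₗ[ℝ] ℝ, TamingWitness p ε J T →
    ∀ β : MForm (𝓡 4) (punctured p) ℝ 1, IsSmoothForm β → T (mextDeriv β) = 0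

/-- **Radius monotonicity of witnesses (consequence of Step 0).** A witness at radius `ε` is a
witness at every radius `ε''` with `ε ≤ ε'' < ε'` ((W2), (W3) are monotone —
`TamingWitness.w2_mono/w3_mono` in tree; (W1) at the larger radius holds because `T` has no
mass in the collar, by `CollarLemma`). -/
def WitnessMonotone : Prop :=
  ∀ (S : HomotopySphere 4) (p : S.carrier)
    (J : ∀ x : punctured p, TangentSpace (𝓡 4) x →L[ℝ] TangentSpace (𝓡 4) x) (ε ε' ε'' : ℝ),
    0 < ε → ε ≤ ε'' → ε'' < ε' →
    Metric.closedBall (extChartAt (𝓡 4) p p) ε' ⊆ (extChartAt (𝓡 4) p).target →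
    IsAdmissibleACS S p J → JStandardOnBall S p ε' J →
    ∀ T : MForm (𝓡 4) (punctured p) ℝ 2 →ₗ[ℝ] ℝ, TamingWitness p ε J T → TamingWitness p ε'' J T

/-- **Bubble / Brody-limit confinement (the maximum principle of the line).** For `J` admissible
and standard on `B_{ε'}`: a non-constant `C^∞` `J`-holomorphic `u : ℂ → Σ ∖ p` whose image
avoids SOME punctured ball `B_η` (i.e. stays away from `p`; e.g. a null-homologous bubble sphere
minus a point, or a Brody limit inside `K_ε`) avoids the whole standard collar `B_{ε'}`.
Proof sketch: where `u ∈ B_{ε'}`, `w := ι ∘ (e − e p) ∘ u` is holomorphic into `ℂ²`, so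
`ρ ∘ u = ‖w‖²` is subharmonic; `v := max(ρ∘u − ε'⁻² − δ, 0)` is subharmonic and bounded on `ℂ`,
hence constant (parabolicity of `ℂ`), hence `0` (a `J`-curve inside a round `S³` is constant:
its tangent planes would be complex lines inside the contact distribution); let `δ → 0`.
In particular the conclusion "avoids `B_ε`" of `WitnessCharge` self-improves to "avoids `B_{ε'}`". -/
def BubbleConfinement : Prop :=
  ∀ (S : HomotopySphere 4) (p : S.carrier)
    (J : ∀ x : punctured p, TangentSpace (𝓡 4) x →L[ℝ] TangentSpace (𝓡 4) x) (ε' : ℝ),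
    0 < ε' →
    Metric.closedBall (extChartAt (𝓡 4) p p) ε' ⊆ (extChartAt (𝓡 4) p).target →
    IsAdmissibleACS S p J → JStandardOnBall S p ε' J →
    ∀ u : ℂ → punctured p, ContMDiff 𝓘(ℝ, ℂ) (𝓡 4) ∞ u → (∃ z z' : ℂ, u z ≠ u z') →
      IsJHolomorphic (𝓡 4) J u →
      (∃ η : ℝ, 0 < η ∧ ∀ z : ℂ, ¬ InPuncturedChartBall p η (u z)) →
      ∀ z : ℂ, ¬ InPuncturedChartBall p ε' (u z)

/-- Sanity: the crux, verbatim, with its `J`-standard clause and its witness clause folded into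
`JStandardOnBall` / `TamingWitness` (definitional: `Iff.rfl`; the line's target is the route decl BY NAME). -/
theorem witnessCharge_iff :
    Theses.SullivanDual.WitnessCharge ↔
    ∀ (S : HomotopySphere 4) (p : S.carrier)
      (J : ∀ x : punctured p, TangentSpace (𝓡 4) x →L[ℝ] TangentSpace (𝓡 4) x) (ε ε' : ℝ),
      0 < ε → ε < ε' →
      Metric.closedBall (extChartAt (𝓡 4) p p) ε' ⊆ (extChartAt (𝓡 4) p).target →
      (∀ (x : punctured p) (v : TangentSpace (𝓡 4) x), J x (J x v) = -v) →
      (∀ x₀ : punctured p, ContMDiffAt (𝓡 4) 𝓘(ℝ, EuclideanSpace ℝ (Fin 4) →L[ℝ] EuclideanSpace ℝ (Fin 4)) ∞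
        (inTangentCoordinates (𝓡 4) (𝓡 4) (id : punctured p → punctured p) id (fun x => J x) x₀) x₀) →
      JStandardOnBall S p ε' J →
      (∃ T : MForm (𝓡 4) (punctured p) ℝ 2 →ₗ[ℝ] ℝ, TamingWitness p ε J T) →
      ∃ u : ℂ → punctured p, (ContMDiff 𝓘(ℝ, ℂ) (𝓡 4) ∞ u ∧ (∃ z z' : ℂ, u z ≠ u z') ∧
        (∀ z ζ : ℂ, mfderiv 𝓘(ℝ, ℂ) (𝓡 4) u z (Complex.I * ζ : ℂ) =
          J (u z) (mfderiv 𝓘(ℝ, ℂ) (𝓡 4) u z (ζ : ℂ))) ∧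
        (∀ z : ℂ, ¬ InPuncturedChartBall p ε (u z))) :=
  Iff.rfl

end Summit.SmoothPoincare4.SmoothPoincare4.Cruxes.WitnessCharge.PencilAtInfinity
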